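import Summits.CriticalPhenomena.Ising3DConformalLimit.Theorems.GapForcesFarMerging.Negative.IsingCertificate
import Summits.CriticalPhenomena.Ising3DConformalLimit.Theorems.MoebiusLimitExists.Negative.FreePermutations
import Summits.CriticalPhenomena.Ising3DConformalLimit.Theorems.HyperoctahedralRPInversionUpgradeNormalisedLatticeRP
import Literature.Probability.LatticeModels.MessagerMiracleSole
import Literature.Probability.LatticeModels.HighDimPointwiseTriviality
import Mathlib.Algebra.QuadraticDiscriminant
import HarnessLib

/-!
# The reflection-positivity Cauchy–Schwarz MOVE INEQUALITY for the critical `ℤ³` correlators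
(stub `moveIneq_latticeRP` of line `only-interaction-breaks-moebius` for crux `MoebiusLimitExists`,
item stmt-CriticalPhenomena-1344, route `EnergyNotSigmaSquared`)

Statement (`moveIneq_latticeRP`).  Fix a coordinate `τ : Fin 3`, an integer height `c` and the
site mirror `θ v = (v with v_τ ↦ 2c - v_τ)` of `ℤ³` in the lattice plane `{v_τ = c}`.  Let two
configurations `y, y'` of `n + 1` sites differ only at the index `i`, with the moving site weakly
on one closed side of the mirror in both (`y i τ, y' i τ ≤ c`, resp. `≥ c`) and all the other
sites `B = (y j)_{j ≠ i}` weakly on the other closed side.  Then, with `G = criticalTwoPoint 3`,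
`(⟨∏ σ_y⟩ − ⟨∏ σ_{y'}⟩)² ≤ [G(yᵢ − θyᵢ) − 2 G(yᵢ − θy'ᵢ) + G(y'ᵢ − θy'ᵢ)] · ⟨∏ⱼ σ_{θBⱼ} ∏ⱼ σ_{Bⱼ}⟩`,
all correlators being the critical infinite-volume ones `criticalCorr 3`.

Proof (Fröhlich–Israel–Lieb–Simon 1978, §2; Friedli–Velenik 2017, Lemma 10.8).
* The Gram form `(a, b) ↦ ⟨∏ σ_{θ z^a} ∏ σ_{z^b}⟩_{β_c}` on spin monomials supported in ONE closed
  half `{v_τ ≥ c}` (resp. `{v_τ ≤ c}`) is positive semidefinite: this is the tree theorem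
  `stub_latticeRP` (site-mirror reflection positivity of `criticalCorr 3` through `{v_τ = 0}`),
  transported to height `c` by the lattice translation `c e_τ` (`criticalCorr_translate`), and to
  the other half by the mirror itself (`θ`-invariance of the critical state,
  `criticalCorr_signedPerm` + `criticalCorr_translate`).
* Apply it to the three monomials `σ_{θp}`, `σ_{θp'}`, `∏ σ_B` (`p = y i`, `p' = y' i`) with
  coefficients `(1, -1, t)`: the result is a quadratic polynomial `C t² + 2 D t + A ≥ 0` in `t`
  with `A = G(p − θp) − 2G(p − θp') + G(p' − θp')` (the two mixed pair entries agree by evenness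
  and mirror invariance of `G`), `D = ⟨∏ σ_y⟩ − ⟨∏ σ_{y'}⟩` (mirror invariance and relabelling of
  the spin monomial, `Fin.prod_univ_succAbove`) and `C = ⟨∏ σ_{θB} ∏ σ_B⟩`.
* `discrim_le_zero`: `(2D)² ≤ 4AC`.

References: J. Fröhlich, R. Israel, E. H. Lieb, B. Simon, Comm. Math. Phys. 62 (1978) 1–34, §2
[FILS1978]; S. Friedli, Y. Velenik, *Statistical Mechanics of Lattice Systems* (CUP 2017),
Lemma 10.8, Exercise 3.14, Thm. 3.17 [FriedliVelenik2017].  No new definitions; nothing about the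
continuum limit is in this file (that is the stub `sepMove_equicontinuity`).
-/

noncomputable section

open Filter Topology Set Function
open Literature.Probability.LatticeModels

namespace Summit.CriticalPhenomena.Ising3DConformalLimit.MoebiusLimitExistsOnlyInteraction

open Summit.CriticalPhenomena.Ising3DConformalLimit.Theorems.GapForcesFarMerging.Negative
  (criticalCorr_translate)
open Summit.CriticalPhenomena.Ising3DConformalLimit.MoebiusLimitExistsNegative (criticalCorr_signedPerm)
open Summit.CriticalPhenomena.Ising3DConformalLimit.Cruxes.InversionUpgradeNormalised.FreeEndpointGaussianClosure
  (stub_latticeRP)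

/-! ### Mirror symmetry of the critical correlators -/

/-- The reflections `v_τ ↦ k - v_τ` of `ℤ³` (a sign change of the coordinate `τ` followed by the
translation `k e_τ`) leave the critical correlators invariant. [cite: FriedliVelenik2017, Exercise 3.14, p. 115] -/
theorem criticalCorr_axisRefl_gen {n : ℕ} (τ : Fin 3) (k : ℤ) (y : Fin n → Site 3) :
    criticalCorr 3 n (fun i => axisRefl τ k (y i)) = criticalCorr 3 n y := by
  have h : (fun i => axisRefl (d := 3) τ k (y i)) =
      fun i => Site.signedPerm (Equiv.refl (Fin 3)) (Function.update 1 τ (-1)) (y i) +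
        Pi.single τ k := rfl
  rw [h, criticalCorr_translate _ (Pi.single τ k), criticalCorr_signedPerm]

/-- The site mirror `v ↦ (v with v_τ ↦ k - v_τ)` written with `Function.update` is `axisRefl τ k`.
[folklore] -/
theorem update_eq_axisRefl (τ : Fin 3) (k : ℤ) (v : Site 3) :
    Function.update v τ (k - v τ) = axisRefl τ k v := by
  funext j
  rw [axisRefl_apply, Function.update_apply]

/-- Mirror invariance of the critical correlators, `Function.update` form:
`⟨∏ σ_{θ yᵢ}⟩_{β_c} = ⟨∏ σ_{yᵢ}⟩_{β_c}` for `θ v = (v with v_τ ↦ k - v_τ)`.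
[cite: FriedliVelenik2017, Exercise 3.14, p. 115] -/
theorem criticalCorr_update_mirror {n : ℕ} (τ : Fin 3) (k : ℤ) (y : Fin n → Site 3) :
    criticalCorr 3 n (fun i => Function.update (y i) τ (k - y i τ)) = criticalCorr 3 n y := by
  simp only [update_eq_axisRefl]
  exact criticalCorr_axisRefl_gen τ k y

/-- The critical two-point function is invariant under the sign change of one coordinate.
[cite: FriedliVelenik2017, Exercise 3.14, p. 115] -/
theorem criticalTwoPoint_update_neg (τ : Fin 3) (v : Site 3) :
    criticalTwoPoint 3 (Function.update v τ (-v τ)) = criticalTwoPoint 3 v := by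
  rw [← criticalCorr_two, ← criticalCorr_two, ← criticalCorr_update_mirror τ 0 ![0, v]]
  congr 1
  funext i
  fin_cases i
  · simp
  · simp

/-- The site mirror `θ v = (v with v_τ ↦ 2c - v_τ)` is an involution. [folklore] -/
theorem update_mirror_mirror (τ : Fin 3) (c : ℤ) (v : Site 3) :
    Function.update (Function.update v τ (2 * c - v τ)) τ
      (2 * c - Function.update v τ (2 * c - v τ) τ) = v := by
  simp

/-- `G(a - θ b) = G(b - θ a)` for the site mirror `θ` at any height: `a - θ b` is the image of
`θ a - b` under the LINEAR mirror `v_τ ↦ -v_τ`, and `G` is even and mirror invariant.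
[cite: FriedliVelenik2017, Exercise 3.14, p. 115] -/
theorem criticalTwoPoint_sub_mirror_comm (τ : Fin 3) (c : ℤ) (a b : Site 3) :
    criticalTwoPoint 3 (a - Function.update b τ (2 * c - b τ)) =
      criticalTwoPoint 3 (b - Function.update a τ (2 * c - a τ)) := by
  rw [← criticalTwoPoint_update_neg τ (a - Function.update b τ (2 * c - b τ)),
    criticalTwoPoint_sub_comm b]
  congr 1
  funext j
  by_cases hj : j = τ
  · subst hj
    simp only [Function.update_self, Pi.sub_apply]
    ring
  · simp [Function.update_of_ne hj]

/-! ### Site-mirror reflection positivity at height `c`, both closed halves -/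

/-- **Site-mirror reflection positivity of `criticalCorr 3` through the plane `{v_τ = c}`, closed
upper half.** For configurations `z^a` in `{v_τ ≥ c}` and real coefficients,
`0 ≤ Σ_{a,b} c_a c_b ⟨∏ σ_{θ z^a ++ z^b}⟩_{β_c}` with `θ v = (v with v_τ ↦ 2c - v_τ)`: the tree's
`stub_latticeRP` (plane through the origin) transported by the translation `c e_τ`
(`criticalCorr_translate`). [cite: FILS1978, §2] -/
theorem latticeRP_height_ge (τ : Fin 3) (c : ℤ) {m : ℕ} (k : Fin m → ℕ)
    (z : (a : Fin m) → Fin (k a) → Site 3) (coef : Fin m → ℝ) (hz : ∀ a i, c ≤ z a i τ) :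
    0 ≤ ∑ a, ∑ b, coef a * coef b * criticalCorr 3 (k a + k b)
      (Fin.append (fun i => Function.update (z a i) τ (2 * c - z a i τ)) (z b)) := by
  have h := stub_latticeRP τ m k (fun a i => z a i - Pi.single τ c) coef (fun a i => by
    have := hz a i
    simp only [Pi.sub_apply, Pi.single_eq_same]
    linarith)
  refine h.trans_eq (Finset.sum_congr rfl fun a _ => Finset.sum_congr rfl fun b _ => ?_)
  congr 1
  rw [← criticalCorr_translate (Fin.append
    (fun i => Function.update (z a i - (Pi.single τ c : Site 3)) τ
      (-((z a i - (Pi.single τ c : Site 3)) τ)))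
    (fun i => z b i - (Pi.single τ c : Site 3))) (Pi.single τ c : Site 3)]
  congr 1
  funext j
  refine Fin.addCases (fun l => ?_) (fun r => ?_) j
  · simp only [Fin.append_left]
    funext q
    by_cases hq : q = τ
    · subst hq
      simp only [Pi.add_apply, Function.update_self, Pi.sub_apply, Pi.single_eq_same]
      ring
    · simp only [Pi.add_apply, Function.update_of_ne hq, Pi.sub_apply, Pi.single_eq_of_ne hq,
        sub_zero, add_zero]
  · simp only [Fin.append_right, sub_add_cancel]

/-- **Site-mirror reflection positivity of `criticalCorr 3` through the plane `{v_τ = c}`, closed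
lower half.** The same Gram inequality for configurations `z^a` in `{v_τ ≤ c}`: apply
`latticeRP_height_ge` to the mirrored configurations `θ z^a` (which lie in the upper half) and use
the `θ`-invariance of the critical state (`criticalCorr_update_mirror`). [cite: FILS1978, §2] -/
theorem latticeRP_height_le (τ : Fin 3) (c : ℤ) {m : ℕ} (k : Fin m → ℕ)
    (z : (a : Fin m) → Fin (k a) → Site 3) (coef : Fin m → ℝ) (hz : ∀ a i, z a i τ ≤ c) :
    0 ≤ ∑ a, ∑ b, coef a * coef b * criticalCorr 3 (k a + k b)
      (Fin.append (fun i => Function.update (z a i) τ (2 * c - z a i τ)) (z b)) := by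
  have h := latticeRP_height_ge τ c k (fun a i => Function.update (z a i) τ (2 * c - z a i τ))
    coef (fun a i => by
      have := hz a i
      simp only [Function.update_self]
      linarith)
  refine h.trans_eq (Finset.sum_congr rfl fun a _ => Finset.sum_congr rfl fun b _ => ?_)
  rw [← criticalCorr_update_mirror τ (2 * c)
    (Fin.append (fun i => Function.update (z a i) τ (2 * c - z a i τ)) (z b))]
  congr 2
  funext j
  refine Fin.addCases (fun l => ?_) (fun r => ?_) j
  · simp only [Fin.append_left]
  · simp only [Fin.append_right]

/-- **The `3 × 3` Gram inequality.** For three spin monomials `z₀, z₁, z₂` supported in one closed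
half of the mirror `{v_τ = c}` and real coefficients `c₀, c₁, c₂`,
`0 ≤ Σ_{a,b ∈ {0,1,2}} c_a c_b ⟨∏ σ_{θ z_a ++ z_b}⟩_{β_c}` (the nine terms written out).
[cite: FILS1978, §2] -/
theorem latticeRP_gram_three (τ : Fin 3) (c : ℤ) {m₀ m₁ m₂ : ℕ} (z₀ : Fin m₀ → Site 3)
    (z₁ : Fin m₁ → Site 3) (z₂ : Fin m₂ → Site 3)
    (hz : ((∀ i, c ≤ z₀ i τ) ∧ (∀ i, c ≤ z₁ i τ) ∧ ∀ i, c ≤ z₂ i τ) ∨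
      ((∀ i, z₀ i τ ≤ c) ∧ (∀ i, z₁ i τ ≤ c) ∧ ∀ i, z₂ i τ ≤ c))
    (c₀ c₁ c₂ : ℝ) :
    0 ≤ c₀ * c₀ * criticalCorr 3 (m₀ + m₀)
          (Fin.append (fun i => Function.update (z₀ i) τ (2 * c - z₀ i τ)) z₀)
        + c₀ * c₁ * criticalCorr 3 (m₀ + m₁)
          (Fin.append (fun i => Function.update (z₀ i) τ (2 * c - z₀ i τ)) z₁)
        + c₀ * c₂ * criticalCorr 3 (m₀ + m₂)
          (Fin.append (fun i => Function.update (z₀ i) τ (2 * c - z₀ i τ)) z₂)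
      + (c₁ * c₀ * criticalCorr 3 (m₁ + m₀)
          (Fin.append (fun i => Function.update (z₁ i) τ (2 * c - z₁ i τ)) z₀)
        + c₁ * c₁ * criticalCorr 3 (m₁ + m₁)
          (Fin.append (fun i => Function.update (z₁ i) τ (2 * c - z₁ i τ)) z₁)
        + c₁ * c₂ * criticalCorr 3 (m₁ + m₂)
          (Fin.append (fun i => Function.update (z₁ i) τ (2 * c - z₁ i τ)) z₂))
      + (c₂ * c₀ * criticalCorr 3 (m₂ + m₀)
          (Fin.append (fun i => Function.update (z₂ i) τ (2 * c - z₂ i τ)) z₀)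
        + c₂ * c₁ * criticalCorr 3 (m₂ + m₁)
          (Fin.append (fun i => Function.update (z₂ i) τ (2 * c - z₂ i τ)) z₁)
        + c₂ * c₂ * criticalCorr 3 (m₂ + m₂)
          (Fin.append (fun i => Function.update (z₂ i) τ (2 * c - z₂ i τ)) z₂)) := by
  let k : Fin 3 → ℕ := ![m₀, m₁, m₂]
  let z : (a : Fin 3) → Fin (k a) → Site 3 := Fin.cons z₀ (Fin.cons z₁ (Fin.cons z₂ finZeroElim))
  have h : 0 ≤ ∑ a, ∑ b, ![c₀, c₁, c₂] a * ![c₀, c₁, c₂] b * criticalCorr 3 (k a + k b)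
      (Fin.append (fun i => Function.update (z a i) τ (2 * c - z a i τ)) (z b)) := by
    rcases hz with ⟨h₀, h₁, h₂⟩ | ⟨h₀, h₁, h₂⟩
    · refine latticeRP_height_ge τ c k z _ fun a => ?_
      fin_cases a
      · exact h₀
      · exact h₁
      · exact h₂
    · refine latticeRP_height_le τ c k z _ fun a => ?_
      fin_cases a
      · exact h₀
      · exact h₁
      · exact h₂
  simp only [Fin.sum_univ_three] at h
  exact h

/-! ### Identification of the Gram entries -/

/-- A pair entry: `⟨σ_{θ a} σ_b⟩ = G(b - θ a)` (the one-site blocks `![a]`, `![b]`). [folklore] -/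
theorem moveGram_pair (τ : Fin 3) (c : ℤ) (a b : Site 3) :
    criticalCorr 3 (1 + 1) (Fin.append
      (fun i => Function.update ((![a] : Fin 1 → Site 3) i) τ
        (2 * c - (![a] : Fin 1 → Site 3) i τ)) ![b]) =
      criticalTwoPoint 3 (b - Function.update a τ (2 * c - a τ)) := by
  rw [← criticalCorr_two_pair]
  exact congrArg (criticalCorr 3 2) (by
    funext j
    fin_cases j
    · rfl
    · rfl)

/-- The point–point entries in final form: `⟨σ_{θθa} σ_{θb}⟩ = G(a - θ b)`. [folklore] -/
theorem moveGram_point_point (τ : Fin 3) (c : ℤ) (a b : Site 3) :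
    criticalCorr 3 (1 + 1) (Fin.append
      (fun i => Function.update
        ((![Function.update a τ (2 * c - a τ)] : Fin 1 → Site 3) i) τ
        (2 * c - (![Function.update a τ (2 * c - a τ)] : Fin 1 → Site 3) i τ))
      ![Function.update b τ (2 * c - b τ)]) =
      criticalTwoPoint 3 (a - Function.update b τ (2 * c - b τ)) := by
  rw [moveGram_pair, update_mirror_mirror, criticalTwoPoint_sub_comm]

/-- The point–block entries: `⟨σ_{θθa} ∏ σ_B⟩ = ⟨σ_a ∏ σ_B⟩`. [folklore] -/
theorem moveGram_point_block (τ : Fin 3) (c : ℤ) {n : ℕ} (a : Site 3) (B : Fin n → Site 3) :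
    criticalCorr 3 (1 + n) (Fin.append
      (fun i => Function.update
        ((![Function.update a τ (2 * c - a τ)] : Fin 1 → Site 3) i) τ
        (2 * c - (![Function.update a τ (2 * c - a τ)] : Fin 1 → Site 3) i τ)) B) =
      criticalCorr 3 (1 + n) (Fin.append ![a] B) := by
  congr 2
  funext i
  fin_cases i
  exact update_mirror_mirror τ c a

/-- Applying a map to a concatenation of two blocks. [folklore] -/
theorem map_finAppend_eq {α β : Type*} {m n : ℕ} (f : α → β) (u : Fin m → α) (v : Fin n → α) :
    (fun j => f (Fin.append u v j)) = Fin.append (fun j => f (u j)) (fun j => f (v j)) := by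
  funext j
  refine Fin.addCases (fun l => ?_) (fun r => ?_) j
  · simp only [Fin.append_left]
  · simp only [Fin.append_right]

/-- The block–point entries: `⟨∏ σ_{θB} σ_{θa}⟩ = ⟨∏ σ_B σ_a⟩` (mirror invariance of the critical
state). [cite: FriedliVelenik2017, Exercise 3.14, p. 115] -/
theorem moveGram_block_point (τ : Fin 3) (c : ℤ) {n : ℕ} (a : Site 3) (B : Fin n → Site 3) :
    criticalCorr 3 (n + 1) (Fin.append (fun i => Function.update (B i) τ (2 * c - B i τ))
      ![Function.update a τ (2 * c - a τ)]) =
      criticalCorr 3 (n + 1) (Fin.append B ![a]) := by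
  rw [← criticalCorr_update_mirror (n := n + 1) τ (2 * c) (Fin.append B ![a]),
    map_finAppend_eq (fun w : Site 3 => Function.update w τ (2 * c - w τ)) B ![a]]
  congr 2
  funext i
  fin_cases i
  rfl

/-- `∏ⱼ σ_{yⱼ} = σ_{yᵢ} ∏_{j ≠ i} σ_{yⱼ}` (`Fin.prod_univ_succAbove`). [folklore] -/
theorem spinMonomial_eq_succAbove {n : ℕ} (i : Fin (n + 1)) (y : Fin (n + 1) → Site 3)
    (s : SpinConfig (Site 3)) :
    spinMonomial y s = spinAt (y i) s * ∏ j, spinAt (y (i.succAbove j)) s := by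
  simp only [spinMonomial]
  rw [Fin.prod_univ_succAbove _ i]

/-- Relabelling: `⟨σ_{yᵢ} ∏_{j ≠ i} σ_{yⱼ}⟩ = ⟨∏ⱼ σ_{yⱼ}⟩`. [folklore] -/
theorem criticalCorr_point_append_succAbove {n : ℕ} (i : Fin (n + 1)) (y : Fin (n + 1) → Site 3) :
    criticalCorr 3 (1 + n) (Fin.append ![y i] (fun j => y (i.succAbove j))) =
      criticalCorr 3 (n + 1) y := by
  show plusExpect 3 (criticalBeta 3) 0 (spinMonomial _) =
    plusExpect 3 (criticalBeta 3) 0 (spinMonomial _)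
  congr 1
  funext s
  rw [spinMonomial_eq_succAbove i y]
  simp only [spinMonomial]
  rw [Fin.prod_univ_add]
  simp only [Fin.prod_univ_one, Fin.append_left, Fin.append_right, Matrix.cons_val_fin_one]

/-- Relabelling: `⟨∏_{j ≠ i} σ_{yⱼ} σ_{yᵢ}⟩ = ⟨∏ⱼ σ_{yⱼ}⟩`. [folklore] -/
theorem criticalCorr_succAbove_append_point {n : ℕ} (i : Fin (n + 1))
    (y : Fin (n + 1) → Site 3) :
    criticalCorr 3 (n + 1) (Fin.append (fun j => y (i.succAbove j)) ![y i]) =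
      criticalCorr 3 (n + 1) y := by
  show plusExpect 3 (criticalBeta 3) 0 (spinMonomial _) =
    plusExpect 3 (criticalBeta 3) 0 (spinMonomial _)
  congr 1
  funext s
  rw [spinMonomial_eq_succAbove i y, mul_comm]
  simp only [spinMonomial]
  rw [Fin.prod_univ_add]
  simp only [Fin.prod_univ_one, Fin.append_left, Fin.append_right, Matrix.cons_val_fin_one]

/-- Cauchy–Schwarz from the discriminant: if `C t² + 2 D t + A ≥ 0` for all real `t` then
`D² ≤ A C` (`discrim_le_zero`). [folklore] -/
theorem moveIneq_of_forall_quadratic_nonneg {A C D : ℝ}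
    (h : ∀ t : ℝ, 0 ≤ C * (t * t) + 2 * D * t + A) : D ^ 2 ≤ A * C := by
  have hd := discrim_le_zero h
  unfold discrim at hd
  nlinarith [hd]

/-! ### The registered stub -/

/-- **STUB 1″a — the RP–Cauchy–Schwarz MOVE INEQUALITY on the lattice.**
Fix a coordinate `τ`, an integer height `c` and the site mirror `θ v = (v with v_τ ↦ 2c − v_τ)` of `ℤ³` in
the plane `{v_τ = c}`. If two configurations `y, y'` of `n + 1` sites differ only at the index `i`, the
moving site lies weakly on ONE closed side of the mirror in both (`y i τ, y' i τ ≤ c`, resp. `≥ c`) and all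
other sites weakly on the OTHER closed side (`c ≤ y j τ`, resp. `y j τ ≤ c`), then
`(⟨∏σ_y⟩ − ⟨∏σ_{y'}⟩)² ≤ [G(yᵢ − θyᵢ) − 2G(yᵢ − θy'ᵢ) + G(y'ᵢ − θy'ᵢ)] · ⟨∏ⱼ σ_{θyⱼ} ∏ⱼ σ_{yⱼ}⟩_{j ≠ i}`
(`G = criticalTwoPoint 3`, all correlators critical, infinite volume). Proof: the Gram form
`(a, b) ↦ ⟨σ_{θzᵃ} σ_{zᵇ}⟩_{β_c}` on spin monomials supported in one closed half-lattice is positive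
semidefinite (`latticeRP_gram_three`, from the tree's `stub_latticeRP` transported by
`criticalCorr_translate` and `criticalCorr_update_mirror`); applied to
`σ_{θyᵢ} − σ_{θy'ᵢ} + t ∏_{j≠i} σ_{yⱼ}` it gives a nonnegative quadratic polynomial in `t` whose
discriminant inequality (`discrim_le_zero`) is the claim, once the entries are identified by mirror
invariance, evenness of `G` and relabelling. [cite: FILS1978, §2] -/
theorem moveIneq_latticeRP :
    ∀ (τ : Fin 3) (c : ℤ) (n : ℕ) (i : Fin (n + 1)) (y y' : Fin (n + 1) → Site 3),
      (∀ j, j ≠ i → y' j = y j) →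
      ((y i τ ≤ c ∧ y' i τ ≤ c ∧ ∀ j, j ≠ i → c ≤ y j τ) ∨
        (c ≤ y i τ ∧ c ≤ y' i τ ∧ ∀ j, j ≠ i → y j τ ≤ c)) →
      (criticalCorr 3 (n + 1) y - criticalCorr 3 (n + 1) y') ^ 2 ≤
        (criticalTwoPoint 3 (y i - Function.update (y i) τ (2 * c - y i τ))
          - 2 * criticalTwoPoint 3 (y i - Function.update (y' i) τ (2 * c - y' i τ))
          + criticalTwoPoint 3 (y' i - Function.update (y' i) τ (2 * c - y' i τ))) *
        criticalCorr 3 (n + n)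
          (Fin.append (fun j => Function.update (y (i.succAbove j)) τ (2 * c - y (i.succAbove j) τ))
            (fun j => y (i.succAbove j))) := by
  intro τ c n i y y' hdiff hside
  -- the other sites, seen from `y'`
  have hB' : (fun j => y' (i.succAbove j)) = fun j => y (i.succAbove j) :=
    funext fun j => hdiff _ (Fin.succAbove_ne i j)
  have hy'1 : criticalCorr 3 (1 + n) (Fin.append ![y' i] (fun j => y (i.succAbove j))) =
      criticalCorr 3 (n + 1) y' := by
    rw [← hB']
    exact criticalCorr_point_append_succAbove i y'
  have hy'2 : criticalCorr 3 (n + 1) (Fin.append (fun j => y (i.succAbove j)) ![y' i]) =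
      criticalCorr 3 (n + 1) y' := by
    rw [← hB']
    exact criticalCorr_succAbove_append_point i y'
  refine moveIneq_of_forall_quadratic_nonneg fun t => ?_
  -- the Gram inequality for `σ_{θ yᵢ}`, `σ_{θ y'ᵢ}`, `∏_{j ≠ i} σ_{yⱼ}` (all in one closed half)
  have h := latticeRP_gram_three τ c ![Function.update (y i) τ (2 * c - y i τ)]
    ![Function.update (y' i) τ (2 * c - y' i τ)] (fun j => y (i.succAbove j)) (by
      rcases hside with ⟨h₁, h₂, h₃⟩ | ⟨h₁, h₂, h₃⟩
      · refine Or.inl ⟨fun l => ?_, fun l => ?_, fun j => h₃ _ (Fin.succAbove_ne i j)⟩ <;>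
          simp only [Matrix.cons_val_fin_one, Function.update_self] <;> linarith
      · refine Or.inr ⟨fun l => ?_, fun l => ?_, fun j => h₃ _ (Fin.succAbove_ne i j)⟩ <;>
          simp only [Matrix.cons_val_fin_one, Function.update_self] <;> linarith) 1 (-1) t
  rw [moveGram_point_point, moveGram_point_point, moveGram_point_point, moveGram_point_point,
    moveGram_point_block, moveGram_point_block, moveGram_block_point, moveGram_block_point,
    criticalCorr_point_append_succAbove, hy'1, criticalCorr_succAbove_append_point, hy'2,
    criticalTwoPoint_sub_mirror_comm τ c (y' i) (y i)] at h
  exact h.trans_eq (by ring)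

end Summit.CriticalPhenomena.Ising3DConformalLimit.MoebiusLimitExistsOnlyInteraction

end
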